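import Summits.Ventures.DiscreteObjects.Hadamard.ConferenceGraph333TwoCells
import Summits.Ventures.DiscreteObjects.Hadamard.ClassSumTrace

/-!
# Automorphisms of order 3 of srg(333,166,82,83): `f ≡ 3 (mod 6)` fixed points — none is fixed-point-free (kernel)

Framing: lottery ticket; floor = certified bounds/negative ranges.  Cell pub-namedobj (venture DiscreteObjects),
target (H) = `H(668)`, hadamard gen 28.  FIRST PRIME-ORDER CENSUS LINE for `srg(333,166,82,83)` ⇔ symmetric
`C(334)` (⇒ `H(668)`; gen 27 `ConferenceGraph333` / `Order334Routes668`), in the style of the `H(668)` census of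
gens 5–18, obtained from the orbit-matrix method with the spectral tool `ClassSumTrace` (`tr R = 0`):
* `mem_orb3_iff` — orbits `{x, σx, σ²x}` of a permutation with `σ³ = 1` as finsets (no quotient types);
* **`order3_fixedPoints_mod_six`** — let `A` be the adjacency matrix of an `srg(333,166,82,83)` (hypotheses of
  `ConferenceGraph333`) and `σ` a permutation of the vertices with `σ³ = 1` preserving adjacency.  Then the number
  `f` of fixed points of `σ` satisfies **`f ≡ 3 (mod 6)`**.  Proof: the `σ`-orbits form an equitable partition of the
  Seidel matrix; the class-sum matrix `R` (indexed by the finite set of orbits) satisfies the identities of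
  `ConferenceGraph333TwoCells`, hence `R³ = 333R` and `Σ_i R_{ii} = 0` (`classSum_trace_zero`, `333` non-square);
  a fixed point contributes `R_{ii} = S_{xx} = 0`, a `3`-orbit contributes `S_{x,σx} + S_{x,σ²x} = 2S_{x,σx} = ±2`
  (invariance + symmetry: adjacency inside an orbit is all-or-nothing); so the number `m` of `3`-orbits is even
  (`ZMod 2` count) and `333 = f + 3m` gives `f ≡ 3 (mod 6)`;
* **`no_fpf_order3_srg333`** — in particular NO automorphism of order `3` is fixed-point-free: no `C(334)`/`H(668)`
  arises from an `srg(333,166,82,83)` with a semiregular `ℤ/3` (or any semiregular group of order divisible by `3`).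
The identity `σ = 1` is allowed (`f = 333 ≡ 3`).  E2 (plain Python): for the Paley graphs `P(13), P(37), P(61),
P(73)` every order-3 automorphism has `f ≡ v (mod 6)` (all have `f = 1`), while `P(9)` (square order, `tr R = 0`
not forced) has fixed-point-free translations of order `3` — the non-squareness of `333` is essential.
Ours (instance and kernel proof; method = orbit matrices, Behbahani–Lam 2011); `srg(333,166,82,83)`, `C(334)`,
`H(668)` untouched.  No `sorry`, no new definitions.
-/

namespace Summit.Ventures.DiscreteObjects.Hadamard

open Finset

/-- `333` is not a square. -/
theorem not_isSquare_333 : ¬ IsSquare (333 : ℕ) := by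
  rintro ⟨r, hr⟩
  have : r ≤ 19 := by nlinarith
  interval_cases r <;> omega

section order3
variable {V : Type*} [Fintype V] [DecidableEq V]

omit [Fintype V] in
/-- The orbit `{x, σx, σ²x}` of a permutation with `σ³ = 1`, as a `Finset`; membership is 'same orbit'. -/
theorem mem_orb3_iff (σ : Equiv.Perm V) (hσ : ∀ x, σ (σ (σ x)) = x) (x y : V) :
    y ∈ ({x, σ x, σ (σ x)} : Finset V) ↔ ({y, σ y, σ (σ y)} : Finset V) = {x, σ x, σ (σ x)} := by
  constructor
  · intro hy
    simp only [Finset.mem_insert, Finset.mem_singleton] at hy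
    rcases hy with rfl | rfl | rfl
    · rfl
    · rw [hσ]; ext z; simp only [Finset.mem_insert, Finset.mem_singleton]; tauto
    · rw [hσ]; ext z; simp only [Finset.mem_insert, Finset.mem_singleton]; tauto
  · intro h
    rw [← h]
    simp

/-- **Order-3 automorphisms of `srg(333,166,82,83)`.**  If `σ` is a permutation of the vertices with `σ³ = 1`
preserving adjacency (`A_{σx,σy} = A_{x,y}`), then the number `f` of fixed points of `σ` satisfies `f ≡ 3 (mod 6)`.
Proof: the orbits of `σ` form an equitable partition of the Seidel matrix `S`; its class-sum matrix `R` has trace `0`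
(`ClassSumTrace`: `R³ = 333R`, `333` non-square); a fixed point contributes `R_{ii} = S_{xx} = 0`, an orbit
`{x, σx, σ²x}` contributes `R_{ii} = S_{x,σx} + S_{x,σ²x} = 2 S_{x,σx} = ±2` (adjacency inside an orbit is all or
nothing); so the number `m` of `3`-orbits is even, and `333 = f + 3m` gives `f ≡ 3 (mod 6)`. -/
theorem order3_fixedPoints_mod_six (hV : Fintype.card V = 333) (A : Matrix V V ℤ)
    (h01 : ∀ x y, A x y = 0 ∨ A x y = 1) (hsymm : ∀ x y, A y x = A x y) (hdiag : ∀ x, A x x = 0)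
    (hk : ∀ x, ∑ y, A x y = 166) (hsrg : ∀ x y, ∑ z, A x z * A z y = 83 * (1 + (if x = y then 1 else 0)) - A x y)
    (σ : Equiv.Perm V) (hσ : ∀ x, σ (σ (σ x)) = x) (hA : ∀ x y, A (σ x) (σ y) = A x y) :
    (univ.filter fun x => σ x = x).card % 6 = 3 := by
  classical
  obtain ⟨hSd, hSo, hSs, hS1, hSS⟩ := seidel_identities_of_conferenceGraph A h01 hsymm hdiag 83
    (by rw [hV]; norm_num) (fun x => by rw [hk x]; norm_num) hsrg
  set S : V → V → ℤ := fun x y => 1 - (if x = y then 1 else 0) - 2 * A x y with hS_def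
  have hSS' : ∀ x y, ∑ z, S x z * S z y = 333 * (if x = y then 1 else 0) - 1 := fun x y => by
    rw [hSS x y, hV]; norm_num
  have hSσ : ∀ x y, S (σ x) (σ y) = S x y := fun x y => by
    simp only [hS_def, hA, σ.injective.eq_iff]
  have hSd' : ∀ x, S x x = 0 := fun x => hSd x
  have hSo' : ∀ x y, x ≠ y → S x y = 1 ∨ S x y = -1 := fun x y => hSo x y
  have hSs' : ∀ x y, S y x = S x y := fun x y => hSs x y
  -- orbits as finsets
  set orb : V → Finset V := fun x => {x, σ x, σ (σ x)} with horb_def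
  have horb_mem : ∀ x y, y ∈ orb x ↔ orb y = orb x := fun x y => mem_orb3_iff σ hσ x y
  have horb_σ : ∀ y, orb (σ y) = orb y := fun y => (horb_mem y (σ y)).mp (by simp [horb_def])
  -- index type: the set of orbits
  set ι := {j : Finset V // j ∈ univ.image orb} with hι_def
  set cls : V → ι := fun x => ⟨orb x, Finset.mem_image_of_mem _ (Finset.mem_univ x)⟩ with hcls_def
  have hcls_eq : ∀ x y, cls y = cls x ↔ orb y = orb x := fun x y => by
    rw [hcls_def, Subtype.mk.injEq]
  have hcls_σ : ∀ y, cls (σ y) = cls y := fun y => (hcls_eq y (σ y)).mpr (horb_σ y)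
  have hcell : ∀ x, (univ.filter fun y => cls y = cls x) = orb x := by
    intro x; ext y
    rw [Finset.mem_filter, hcls_eq, ← horb_mem]
    simp
  -- representatives
  have hrep : ∀ i : ι, ∃ x, cls x = i := by
    rintro ⟨j, hj⟩
    obtain ⟨x, -, hx⟩ := Finset.mem_image.mp hj
    exact ⟨x, Subtype.ext hx⟩
  choose rep hrep using hrep
  -- class sums and equitability
  set R : Matrix ι ι ℤ := fun i j => ∑ y ∈ univ.filter (fun y => cls y = j), S (rep i) y with hR_def
  have hshift : ∀ r (j : ι), ∑ y ∈ univ.filter (fun y => cls y = j), S (σ r) y =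
      ∑ y ∈ univ.filter (fun y => cls y = j), S r y := by
    intro r j
    rw [Finset.sum_filter, Finset.sum_filter]
    exact Fintype.sum_equiv σ.symm _ _ fun y => by
      rw [show cls y = cls (σ (σ.symm y)) by rw [Equiv.apply_symm_apply], hcls_σ,
        show S (σ r) y = S (σ r) (σ (σ.symm y)) by rw [Equiv.apply_symm_apply], hSσ]
  have key : ∀ (r x' : V) (j : ι), x' ∈ orb r →
      ∑ y ∈ univ.filter (fun y => cls y = j), S x' y = ∑ y ∈ univ.filter (fun y => cls y = j), S r y := by
    intro r x' j hx'
    simp only [horb_def, Finset.mem_insert, Finset.mem_singleton] at hx'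
    rcases hx' with rfl | rfl | rfl
    · rfl
    · exact hshift r j
    · rw [hshift, hshift]
  have hR : ∀ x j, ∑ y ∈ univ.filter (fun y => cls y = j), S x y = R (cls x) j := by
    intro x j
    have hx : x ∈ orb (rep (cls x)) := by rw [horb_mem, ← hcls_eq, hrep]
    exact key _ _ j hx
  -- identities and the trace
  have hids := fun i k => seidel333_classSum_identities S hSs hS1 hSS' cls R hR i k (rep i) (hrep i)
  have htr : ∑ i, R i i = 0 := by
    refine classSum_trace_zero R 333 not_isSquare_333 (fun k => ((univ.filter fun y => cls y = k).card : ℤ))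
      (fun i => (hids i i).1) fun i k => ?_
    rw [(hids i k).2.1]
    push_cast
    ring
  -- diagonal entries
  have hdiagR : ∀ i, R i i = if σ (rep i) = rep i then 0 else 2 * S (rep i) (σ (rep i)) := by
    intro i
    have h0 : R i i = ∑ y ∈ orb (rep i), S (rep i) y := by
      rw [hR_def]; simp only; rw [← hcell (rep i), hrep]
    rw [h0, horb_def]
    simp only
    split_ifs with hfix
    · rw [hfix, hfix, Finset.insert_eq_of_mem (by simp), Finset.insert_eq_of_mem (by simp), Finset.sum_singleton]
      exact hSd' _
    · have h1 : rep i ≠ σ (rep i) := fun h => hfix h.symm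
      have h2 : rep i ≠ σ (σ (rep i)) := fun h => hfix (by
        have := congrArg σ h; rw [hσ] at this; exact this)
      have h3 : σ (rep i) ≠ σ (σ (rep i)) := fun h => hfix (σ.injective h).symm
      rw [Finset.sum_insert (by simp [h1, h2]), Finset.sum_pair h3, hSd']
      have h4 : S (rep i) (σ (σ (rep i))) = S (rep i) (σ (rep i)) := by
        rw [← hSσ (rep i) (σ (σ (rep i))), hσ, hSs']
      rw [h4]; ring
  -- the set T of 3-orbits has even size
  set T := (univ : Finset ι).filter (fun i => σ (rep i) ≠ rep i) with hT_def
  have hTeven : 2 ∣ T.card := by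
    have hsumT : ∑ i ∈ T, S (rep i) (σ (rep i)) = 0 := by
      have h := htr
      rw [Finset.sum_congr rfl fun i _ => hdiagR i, Finset.sum_ite, Finset.sum_const_zero, zero_add,
        ← Finset.mul_sum] at h
      have h' : ∑ i ∈ univ.filter (fun i => ¬ σ (rep i) = rep i), S (rep i) (σ (rep i)) = 0 := by linarith
      rw [hT_def]; convert h' using 2
    have hcast : ((∑ i ∈ T, S (rep i) (σ (rep i)) : ℤ) : ZMod 2) = (T.card : ZMod 2) := by
      rw [Int.cast_sum, Finset.card_eq_sum_ones, Nat.cast_sum]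
      refine Finset.sum_congr rfl fun i hi => ?_
      have hne : rep i ≠ σ (rep i) := fun h => (Finset.mem_filter.mp hi).2 h.symm
      rcases hSo' (rep i) (σ (rep i)) hne with h | h <;> rw [h] <;> decide
    rw [hsumT, Int.cast_zero] at hcast
    exact (ZMod.natCast_eq_zero_iff _ 2).mp hcast.symm
  -- counting points: 333 = f + 3 |T| and f = number of fixed orbits
  have horb_card : ∀ i, (orb (rep i)).card = if σ (rep i) = rep i then 1 else 3 := by
    intro i
    rw [horb_def]; simp only
    split_ifs with hfix
    · rw [hfix, hfix]; simp
    · have h1 : rep i ≠ σ (rep i) := fun h => hfix h.symm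
      have h2 : rep i ≠ σ (σ (rep i)) := fun h => hfix (by
        have := congrArg σ h; rw [hσ] at this; exact this)
      have h3 : σ (rep i) ≠ σ (σ (rep i)) := fun h => hfix (σ.injective h).symm
      rw [Finset.card_insert_of_notMem (by simp [h1, h2]), Finset.card_pair h3]
  have horb_fixed : ∀ i, ((orb (rep i)).filter fun y => σ y = y).card = if σ (rep i) = rep i then 1 else 0 := by
    intro i
    rw [horb_def]; simp only
    split_ifs with hfix
    · rw [hfix, hfix, Finset.insert_eq_of_mem (by simp), Finset.insert_eq_of_mem (by simp), Finset.filter_singleton,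
        if_pos hfix, Finset.card_singleton]
    · have hn1 : ¬ σ (σ (rep i)) = σ (rep i) := fun h => hfix (σ.injective h)
      have hn2 : ¬ σ (σ (σ (rep i))) = σ (σ (rep i)) := fun h => hn1 (σ.injective h)
      rw [Finset.card_eq_zero, Finset.filter_eq_empty_iff]
      intro y hy
      simp only [Finset.mem_insert, Finset.mem_singleton] at hy
      rcases hy with rfl | rfl | rfl
      · exact hfix
      · exact hn1
      · exact hn2
  have h333 : (333 : ℕ) = ∑ i : ι, (orb (rep i)).card := by
    rw [← hV, ← Finset.card_univ, Finset.card_eq_sum_card_fiberwise (f := cls) (t := univ)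
      fun _ _ => Finset.mem_univ _]
    exact Finset.sum_congr rfl fun i _ => by rw [← hrep i, hcell, hrep]
  have hf : (univ.filter fun x => σ x = x).card = ∑ i : ι, ((orb (rep i)).filter fun y => σ y = y).card := by
    rw [Finset.card_eq_sum_card_fiberwise (f := cls) (s := univ.filter fun x => σ x = x) (t := univ)
      fun _ _ => Finset.mem_univ _]
    refine Finset.sum_congr rfl fun i _ => congrArg Finset.card ?_
    ext y
    rw [Finset.mem_filter, Finset.mem_filter, Finset.mem_filter, ← hcell (rep i), Finset.mem_filter, hrep]
    tauto
  rw [Finset.sum_congr rfl fun i _ => horb_card i, Finset.sum_ite, Finset.sum_const, Finset.sum_const] at h333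
  rw [Finset.sum_congr rfl fun i _ => horb_fixed i, Finset.sum_ite, Finset.sum_const, Finset.sum_const] at hf
  simp only [smul_eq_mul, mul_one, mul_zero, add_zero] at h333 hf
  have hTc : (univ.filter fun i : ι => ¬ σ (rep i) = rep i).card = T.card := by rw [hT_def]
  rw [hTc] at h333
  obtain ⟨m, hm⟩ := hTeven
  omega

/-- **No fixed-point-free automorphism of order 3** of an `srg(333,166,82,83)` (e.g. no semiregular `ℤ/3`, and a
fortiori no semiregular group of order divisible by 3 acting with all orbits of size 3). -/
theorem no_fpf_order3_srg333 (hV : Fintype.card V = 333) (A : Matrix V V ℤ)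
    (h01 : ∀ x y, A x y = 0 ∨ A x y = 1) (hsymm : ∀ x y, A y x = A x y) (hdiag : ∀ x, A x x = 0)
    (hk : ∀ x, ∑ y, A x y = 166) (hsrg : ∀ x y, ∑ z, A x z * A z y = 83 * (1 + (if x = y then 1 else 0)) - A x y)
    (σ : Equiv.Perm V) (hσ : ∀ x, σ (σ (σ x)) = x) (hA : ∀ x y, A (σ x) (σ y) = A x y)
    (hfpf : ∀ x, σ x ≠ x) : False := by
  have h := order3_fixedPoints_mod_six hV A h01 hsymm hdiag hk hsrg σ hσ hA
  rw [Finset.filter_eq_empty_iff.mpr (fun x _ => hfpf x), Finset.card_empty] at h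
  omega

end order3

end Summit.Ventures.DiscreteObjects.Hadamard
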